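import Summits.NavierStokesRegularity.NavierStokesRegularity.Theorems.EulerZoomLiouvillePowerGaugeEulerLiouvilleBreatherWeakProfileLarge
import Summits.NavierStokesRegularity.NavierStokesRegularity.Theorems.EulerZoomLiouvillePowerGaugeEulerLiouvilleBreatherWeakPressureLarge
import Summits.NavierStokesRegularity.NavierStokesRegularity.Theorems.EulerZoomLiouvillePowerGaugeEulerLiouvilleBreatherWeakPressure
import Summits.NavierStokesRegularity.NavierStokesRegularity.Theorems.EulerZoomLiouvillePowerGaugeEulerLiouvilleBreatherWeakLEI
import Summits.NavierStokesRegularity.NavierStokesRegularity.Theorems.EulerZoomLiouvillePowerGaugeEulerLiouvilleWeakProfileRigidity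
import Summits.NavierStokesRegularity.NavierStokesRegularity.Theorems.EulerZoomLiouvillePowerGaugeEulerLiouvilleBreatherLocData

/-!
# Crux `EulerZoomLiouville.PowerGaugeEulerLiouville` (stmt-NavierStokesRegularity-19832), line `logtime-breathers` (T3, weak residue, PAST form):
# the profile of a weak contracting breather vanishes — from LARGE-SCALE gauges only

Width seat `ns-ezl-w4` (g3; weak breather rigidity, past form, file L3).  Twin of `…BreatherWeakLocData` + `…BreatherWeakRigidity` in which the three-gauge
bound is required only at radii `a ≥ 1`: this is all a TIME-TRANSLATED member `ũ(s) = u(T₁ + s)` retains (`Q_a(0,0) + (T₁,0) ⊆ Q_{a'}(0,0)`), and it is all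
the one-sided scale-ODE rigidity ever used (the cut-off energy inequality `BreatherWeak.profile_energy_le` needs no gauge at all; the profile data (A₁)(E₁)(D₁)
live at `L ≥ 1`).

* `BreatherWeak.exists_locData_of_large` — (A₁)(E₁)(D₁) with one constant from gauges at `a ≥ 1`;
* `BreatherWeak.profile_ae_eq_zero_of_largeGauge_of_contractingBreather_pressure` — `c > 0`, exact breather pressure ⇒ `V = 0` a.e.

WHAT THIS IS NOT: not NS regularity, not the crux — the engine of the PAST weak breather stratum (sequel `…BreatherWeakPast`); `--supports` stmt-19832. [folklore]
-/

noncomputable section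

set_option linter.dupNamespace false

open MeasureTheory Set Filter Topology Metric Function TopologicalSpace
open scoped ENNReal NNReal RealInnerProductSpace ContDiff Laplacian

namespace Summit.NavierStokesRegularity.NavierStokesRegularity.Theorems.PowerGaugeEulerLiouville

open Literature.Analysis Literature.Analysis.FunctionSpaces Literature.Analysis.FluidPDE

namespace BreatherWeak

variable {u : ℝ → EuclideanSpace ℝ (Fin 3) → EuclideanSpace ℝ (Fin 3)} {p : ℝ → EuclideanSpace ℝ (Fin 3) → ℝ}
  {H : ℝ → EuclideanSpace ℝ (Fin 3) → EuclideanSpace ℝ (Fin 3) →L[ℝ] EuclideanSpace ℝ (Fin 3)}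
  {c : ℝ} {V : EuclideanSpace ℝ (Fin 3) → EuclideanSpace ℝ (Fin 3)} {Q : EuclideanSpace ℝ (Fin 3) → ℝ}

/-- **LARGE-SCALE CLASS DATA OF A WEAK BREATHER IN PROFILE VARIABLES from gauges at radii `a ≥ 1` only.**  Under the weak-gradient hypothesis
and the three-gauge bound at LARGE scales `a ≥ 1` (`0 < ρ ≤ ½`), for `u(τ, y) = e^{cτ} V(e^{−cτ} y)`, `p(τ, y) = (e^{cτ})² Q(e^{−cτ} y)` (`τ < 0`,
`p` a.e.-strongly measurable on the slab) there are a profile gradient `G` (a.e.-strongly measurable, a weak derivative of `V` on `ℝ³`) and ONE constant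
`c'` with, for all `L ≥ 1`: `∫_{B_L}|V|² ≤ c' L^{1−2ρ}`, `∫_{B_L}|G|²_F ≤ L^{1−ρ}((1−ρ)/(2+ρ))c'`, `∫_{B_L}|Q|^{3/2} ≤ L^{2−2ρ}((2−2ρ)/(2+ρ))c'`; and `V` is
a.e.-strongly measurable (twin of `exists_locData` on the large-scale bricks). [folklore] -/
theorem exists_locData_of_large {ρ : ℝ} (hρ : 0 < ρ) (hρh : ρ ≤ 1 / 2) {c₀ : ℝ≥0}
    (hH : HasWeakSpatialGradientOn (slab (EuclideanSpace ℝ (Fin 3)) (Iio 0) isOpen_Iio) u H)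
    (hgauge : ∀ a : ℝ, 1 ≤ a →
      ENNReal.ofReal (a ^ (2 * ρ)) * cknA a (0 : ℝ × EuclideanSpace ℝ (Fin 3)) u +
          ENNReal.ofReal (a ^ ρ) * cknE a (0 : ℝ × EuclideanSpace ℝ (Fin 3)) H +
        ENNReal.ofReal (a ^ (2 * ρ)) * cknD a (0 : ℝ × EuclideanSpace ℝ (Fin 3)) p ≤ (c₀ : ℝ≥0∞))
    (hpm : AEStronglyMeasurable (uncurry p)
      (volume.restrict (Iio (0 : ℝ) ×ˢ (univ : Set (EuclideanSpace ℝ (Fin 3))))))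
    (hbr : ∀ τ : ℝ, τ < 0 → ∀ y, u τ y = Real.exp (c * τ) • V (Real.exp (-(c * τ)) • y))
    (hp : ∀ τ : ℝ, τ < 0 → ∀ y, p τ y = Real.exp (c * τ) ^ 2 * Q (Real.exp (-(c * τ)) • y)) :
    ∃ (G : EuclideanSpace ℝ (Fin 3) → EuclideanSpace ℝ (Fin 3) →L[ℝ] EuclideanSpace ℝ (Fin 3)) (c' : ℝ≥0),
      AEStronglyMeasurable V volume ∧ AEStronglyMeasurable G volume ∧
      HasWeakFDerivOn (⊤ : Opens (EuclideanSpace ℝ (Fin 3))) volume V G ∧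
      (∀ L : ℝ, 1 ≤ L → ∫⁻ y in ball (0 : EuclideanSpace ℝ (Fin 3)) L, ‖V y‖ₑ ^ 2 ≤
        (c' : ℝ≥0∞) * ENNReal.ofReal (L ^ (1 - 2 * ρ))) ∧
      (∀ L : ℝ, 1 ≤ L →
        ∫⁻ y in ball (0 : EuclideanSpace ℝ (Fin 3)) L, ENNReal.ofReal (frobeniusNormSq (G y)) ≤
          ENNReal.ofReal (L ^ (1 - ρ)) * (ENNReal.ofReal ((1 - ρ) / (2 + ρ)) * (c' : ℝ≥0∞))) ∧
      (∀ L : ℝ, 1 ≤ L →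
        ∫⁻ y in ball (0 : EuclideanSpace ℝ (Fin 3)) L, ‖Q y‖ₑ ^ (3 / 2 : ℝ) ≤
          ENNReal.ofReal (L ^ (2 - 2 * ρ)) * (ENNReal.ofReal ((2 - 2 * ρ) / (2 + ρ)) * (c' : ℝ≥0∞))) := by
  -- verbatim `exists_locData` (…BreatherWeakLocData) with the LARGE-SCALE bricks
  have hρ1 : ρ < 1 := by linarith
  have h2ρ : (0 : ℝ) < 2 + ρ := by linarith
  -- the three gauges separately
  have hA : ∀ a : ℝ, 1 ≤ a → ENNReal.ofReal (a ^ (2 * ρ)) *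
      cknA a (0 : ℝ × EuclideanSpace ℝ (Fin 3)) u ≤ (c₀ : ℝ≥0∞) :=
    fun a ha => le_trans (le_trans le_self_add le_self_add) (hgauge a ha)
  have hE : ∀ a : ℝ, 1 ≤ a → ENNReal.ofReal (a ^ ρ) *
      cknE a (0 : ℝ × EuclideanSpace ℝ (Fin 3)) H ≤ (c₀ : ℝ≥0∞) :=
    fun a ha => le_trans (le_trans le_add_self le_self_add) (hgauge a ha)
  have hD : ∀ a : ℝ, 1 ≤ a → ENNReal.ofReal (a ^ (2 * ρ)) *
      cknD a (0 : ℝ × EuclideanSpace ℝ (Fin 3)) p ≤ (c₀ : ℝ≥0∞) :=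
    fun a ha => le_trans le_add_self (hgauge a ha)
  -- measurability of `u`, `H` on the slab; the profile and its weak gradient
  have hum : AEStronglyMeasurable (uncurry u)
      (volume.restrict (Iio (0 : ℝ) ×ˢ (univ : Set (EuclideanSpace ℝ (Fin 3))))) := by
    have := hH.locallyIntegrableOn.aestronglyMeasurable
    simpa [slab] using this
  have hHm : AEStronglyMeasurable (uncurry H)
      (volume.restrict (Iio (0 : ℝ) ×ˢ (univ : Set (EuclideanSpace ℝ (Fin 3))))) := by
    have := hH.locallyIntegrableOn_grad.aestronglyMeasurable
    simpa [slab] using this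
  have hVm : AEStronglyMeasurable V volume := aestronglyMeasurable_profile hum hbr
  obtain ⟨G, hGm, hVG, hHV⟩ := exists_profileGradient_ae hH hbr
  -- ### raw growth bounds
  set CA : ℝ≥0∞ := ENNReal.ofReal (Real.exp (5 * |c|) * Real.exp |c| ^ (1 - 2 * ρ)) * (c₀ : ℝ≥0∞) with hCA
  have hCAt : CA ≠ ⊤ := ENNReal.mul_ne_top ENNReal.ofReal_ne_top ENNReal.coe_ne_top
  have hA1 : ∀ L : ℝ, 1 ≤ L → ∫⁻ y in ball (0 : EuclideanSpace ℝ (Fin 3)) L, ‖V y‖ₑ ^ 2 ≤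
      CA * ENNReal.ofReal (L ^ (1 - 2 * ρ)) :=
    fun L hL => lintegral_ball_profile_le_of_large hA hbr hL
  set CE : ℝ≥0∞ := ENNReal.ofReal (Real.exp (6 * |c|) * Real.exp (2 * |c|) ^ (1 - ρ)) * (c₀ : ℝ≥0∞) with hCE
  have hE2 : ∀ L : ℝ, 2 ≤ L →
      ∫⁻ y in ball (0 : EuclideanSpace ℝ (Fin 3)) L, ENNReal.ofReal (frobeniusNormSq (G y)) ≤
        CE * ENNReal.ofReal (L ^ (1 - ρ)) :=
    profile_gradient_growth_of_gaugeE_of_large hHm hHV hE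
  set CD : ℝ≥0∞ := ENNReal.ofReal (Real.exp (12 * |c|) * Real.exp (2 * |c|) ^ (2 - 2 * ρ)) * (c₀ : ℝ≥0∞) with hCD
  have hD2 : ∀ L : ℝ, 2 ≤ L → ∫⁻ y in ball (0 : EuclideanSpace ℝ (Fin 3)) L, ‖Q y‖ₑ ^ (3 / 2 : ℝ) ≤
      CD * ENNReal.ofReal (L ^ (2 - 2 * ρ)) :=
    fun L hL => profile_pressure_growth_of_gaugeD_of_large hpm hp hD hL
  -- ### thresholds to `L ≥ 1`
  have h12 : (1 : ℝ) ≤ 2 := by norm_num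
  have hE1 := Past.growth_ge_one_of_growth_ge h12 (by linarith : (0 : ℝ) ≤ 1 - ρ) hE2
  have hD1 := Past.growth_ge_one_of_growth_ge h12 (by linarith : (0 : ℝ) ≤ 2 - 2 * ρ) hD2
  set CE' : ℝ≥0∞ := CE * ENNReal.ofReal ((2 : ℝ) ^ (1 - ρ)) with hCE'
  set CD' : ℝ≥0∞ := CD * ENNReal.ofReal ((2 : ℝ) ^ (2 - 2 * ρ)) with hCD'
  have hCE't : CE' ≠ ⊤ :=
    ENNReal.mul_ne_top (ENNReal.mul_ne_top ENNReal.ofReal_ne_top ENNReal.coe_ne_top) ENNReal.ofReal_ne_top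
  have hCD't : CD' ≠ ⊤ :=
    ENNReal.mul_ne_top (ENNReal.mul_ne_top ENNReal.ofReal_ne_top ENNReal.coe_ne_top) ENNReal.ofReal_ne_top
  -- ### ONE common constant in the shapes (A₁), (E₁), (D₁)
  set κE : ℝ := (1 - ρ) / (2 + ρ) with hκE
  set κD : ℝ := (2 - 2 * ρ) / (2 + ρ) with hκD
  have hκE0 : 0 < κE := by rw [hκE]; exact div_pos (by linarith) h2ρ
  have hκD0 : 0 < κD := by rw [hκD]; exact div_pos (by linarith) h2ρ
  set a : ℝ := CA.toReal with ha
  set e : ℝ := CE'.toReal with he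
  set d : ℝ := CD'.toReal with hd
  have ha0 : 0 ≤ a := ENNReal.toReal_nonneg
  have he0 : 0 ≤ e := ENNReal.toReal_nonneg
  have hd0 : 0 ≤ d := ENNReal.toReal_nonneg
  set k₀ : ℝ := a + e / κE + d / κD with hk₀
  have hk₀0 : 0 ≤ k₀ := by positivity
  set c' : ℝ≥0 := k₀.toNNReal with hc'
  have hcc : (c' : ℝ≥0∞) = ENNReal.ofReal k₀ := rfl
  have haC : CA = ENNReal.ofReal a := (ENNReal.ofReal_toReal hCAt).symm
  have heC : CE' = ENNReal.ofReal e := (ENNReal.ofReal_toReal hCE't).symm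
  have hdC : CD' = ENNReal.ofReal d := (ENNReal.ofReal_toReal hCD't).symm
  have hAle : CA ≤ (c' : ℝ≥0∞) := by
    rw [haC, hcc]
    refine ENNReal.ofReal_le_ofReal ?_
    have : 0 ≤ e / κE + d / κD := by positivity
    rw [hk₀]; linarith
  have hEle : CE' ≤ ENNReal.ofReal κE * (c' : ℝ≥0∞) := by
    rw [heC, hcc, ← ENNReal.ofReal_mul hκE0.le]
    refine ENNReal.ofReal_le_ofReal ?_
    have h1 : κE * (e / κE) = e := mul_div_cancel₀ e hκE0.ne'
    have h2 : 0 ≤ κE * a + κE * (d / κD) := by positivity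
    rw [hk₀]; nlinarith [h1, h2]
  have hDle : CD' ≤ ENNReal.ofReal κD * (c' : ℝ≥0∞) := by
    rw [hdC, hcc, ← ENNReal.ofReal_mul hκD0.le]
    refine ENNReal.ofReal_le_ofReal ?_
    have h1 : κD * (d / κD) = d := mul_div_cancel₀ d hκD0.ne'
    have h2 : 0 ≤ κD * a + κD * (e / κE) := by positivity
    rw [hk₀]; nlinarith [h1, h2]
  refine ⟨G, c', hVm, hGm, hVG, fun L hL => (hA1 L hL).trans (mul_le_mul' hAle le_rfl),
    fun L hL => (hE1 L hL).trans ?_, fun L hL => (hD1 L hL).trans ?_⟩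
  · rw [mul_comm]; exact mul_le_mul' le_rfl hEle
  · rw [mul_comm]; exact mul_le_mul' le_rfl hDle

/-- **THE PROFILE OF A WEAK CONTRACTING BREATHER WITH SLAVED PRESSURE VANISHES — LARGE-SCALE gauges only.**  Suitable weak Euler pair on the slab
with weak gradient `H`, the three-gauge bound only at radii `a ≥ 1` (`0 < ρ ≤ ½`), `u(τ, y) = e^{cτ}V(e^{−cτ}y)` and `p(τ, y) = (e^{cτ})² Q(e^{−cτ} y)` for
all `τ < 0` with `c > 0` and `Q` measurable ⇒ `V = 0` a.e. (hence `u = 0` a.e. on the slab, `ae_eq_zero_of_largeGauge_of_contractingBreather_pressure`).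
The form consumed by the PAST version through time translation. [folklore] -/
theorem profile_ae_eq_zero_of_largeGauge_of_contractingBreather_pressure {ρ : ℝ} (hρ : 0 < ρ) (hρh : ρ ≤ 1 / 2) {c₀ : ℝ≥0}
    (hsw : IsSuitableWeakSolutionOn (slab (EuclideanSpace ℝ (Fin 3)) (Iio 0) isOpen_Iio) 0 0 u p)
    (hH : HasWeakSpatialGradientOn (slab (EuclideanSpace ℝ (Fin 3)) (Iio 0) isOpen_Iio) u H)
    (hgauge : ∀ a : ℝ, 1 ≤ a →
      ENNReal.ofReal (a ^ (2 * ρ)) * cknA a (0 : ℝ × EuclideanSpace ℝ (Fin 3)) u +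
          ENNReal.ofReal (a ^ ρ) * cknE a (0 : ℝ × EuclideanSpace ℝ (Fin 3)) H +
        ENNReal.ofReal (a ^ (2 * ρ)) * cknD a (0 : ℝ × EuclideanSpace ℝ (Fin 3)) p ≤ (c₀ : ℝ≥0∞))
    {c : ℝ} (hc : 0 < c) {V : EuclideanSpace ℝ (Fin 3) → EuclideanSpace ℝ (Fin 3)} {Q : EuclideanSpace ℝ (Fin 3) → ℝ}
    (hQ : Measurable Q)
    (hbr : ∀ τ : ℝ, τ < 0 → ∀ y, u τ y = Real.exp (c * τ) • V (Real.exp (-(c * τ)) • y))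
    (hp : ∀ τ : ℝ, τ < 0 → ∀ y, p τ y = Real.exp (c * τ) ^ 2 * Q (Real.exp (-(c * τ)) • y)) :
    V =ᵐ[volume] 0 := by
  have hρ1 : ρ < 1 := by linarith
  -- ### measurability on the slab
  have hum : AEStronglyMeasurable (uncurry u)
      (volume.restrict (Iio (0 : ℝ) ×ˢ (univ : Set (EuclideanSpace ℝ (Fin 3))))) := by
    have := hH.locallyIntegrableOn.aestronglyMeasurable
    simpa [slab] using this
  have hpm : AEStronglyMeasurable (uncurry p)
      (volume.restrict (Iio (0 : ℝ) ×ˢ (univ : Set (EuclideanSpace ℝ (Fin 3))))) := by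
    have h := hsw.distributional.2.2.1.aestronglyMeasurable; rwa [coe_slab] at h
  have hQm : AEStronglyMeasurable Q volume := hQ.aestronglyMeasurable
  -- ### the profile data
  obtain ⟨G, c', hVm, hGm, hVG, hA, hE, hD⟩ := exists_locData_of_large hρ hρh hH hgauge hpm hbr hp
  have hV2 : LocallyIntegrable (fun y => ‖V y‖ ^ 2) volume :=
    EnergySaturation.locallyIntegrable_norm_sq_of_growth_loc hVm hA
  have hQ1 : LocallyIntegrable Q volume := by
    have hD' : ∀ L : ℝ, 1 ≤ L → ∫⁻ y in ball (0 : EuclideanSpace ℝ (Fin 3)) L, ‖Q y‖ₑ ^ (3 / 2 : ℝ) ≤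
        (ENNReal.ofReal ((2 - 2 * ρ) / (2 + ρ)) * (c' : ℝ≥0∞)) * ENNReal.ofReal (L ^ (2 - 2 * ρ)) :=
      fun L hL => (hD L hL).trans (le_of_eq (mul_comm _ _))
    have hQ32R := Past.memLp_threeHalves_ball_of_lintegral_lt_top hQm
      (Past.lintegral_ball_lt_top_of_growth (ENNReal.mul_ne_top ENNReal.ofReal_ne_top ENNReal.coe_ne_top) hD')
    refine (locallyIntegrable_iff).2 fun K hK => ?_
    obtain ⟨r, hr⟩ := hK.isBounded.subset_ball (0 : EuclideanSpace ℝ (Fin 3))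
    haveI : IsFiniteMeasure ((volume : Measure (EuclideanSpace ℝ (Fin 3))).restrict
        (ball (0 : EuclideanSpace ℝ (Fin 3)) r)) :=
      isFiniteMeasure_restrict.2 measure_ball_lt_top.ne
    have h : IntegrableOn Q (ball (0 : EuclideanSpace ℝ (Fin 3)) r) volume :=
      memLp_one_iff_integrable.1 ((hQ32R r).mono_exponent (by
        rw [ENNReal.le_div_iff_mul_le (Or.inl (by norm_num)) (Or.inl (by norm_num))]; norm_num))
    exact h.mono_set hr
  have hPoisson : ∀ θ : EuclideanSpace ℝ (Fin 3) → ℝ, ContDiff ℝ (⊤ : ℕ∞) θ → HasCompactSupport θ →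
      ∫ y, Q y * (Δ θ) y = -∫ y, fderiv ℝ (fderiv ℝ θ) y (V y) (V y) :=
    fun θ hθ hθc => profile_pressure_poisson hsw.distributional hVm hbr hp hV2 hQ1 hθ hθc
  -- ### `|V|³`, `|Q||V| ∈ L¹_loc` from the flux chain
  obtain ⟨σ, hσs, hσc, h0, h1, hone, hzero, -⟩ := exists_radialCutoff
  have hσ : IsTestFunctionOn (⊤ : Opens (EuclideanSpace ℝ (Fin 3))) σ := ⟨hσs, hσc, fun _ _ => trivial⟩
  obtain ⟨M, hM⟩ := (hσs.continuous_fderiv (by simp)).bounded_above_of_compact_support (hσc.fderiv (𝕜 := ℝ))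
  have hV3 : LocallyIntegrable (fun y => ‖V y‖ ^ 3) volume :=
    (EnergySaturation.locallyIntegrable_norm_cube_loc hρ hρ1 hσ h0 h1 hone hzero hM hVm hGm hVG hA hE).2
  have hQV : LocallyIntegrable (fun y => |Q y| * ‖V y‖) volume :=
    (EnergySaturation.locallyIntegrable_pressure_velocity_loc hρ hρ1 hσ h0 h1 hone hzero hM hVm hQm hGm hVG hA hE
      hD hPoisson).2
  -- ### the one-sided profile energy inequality and the scale-ODE rigidity
  have hLE : ∀ θ : EuclideanSpace ℝ (Fin 3) → ℝ, IsTestFunctionOn (⊤ : Opens (EuclideanSpace ℝ (Fin 3))) θ →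
      (∀ z, 0 ≤ θ z) → ∀ L : ℝ, 0 < L →
        (-5) * (-c) * ∫ x, θ (L⁻¹ • x) * ‖V x‖ ^ 2 ≤
          (∫ x, (‖V x‖ ^ 2 + 2 * Q x) * ⟪V x, gradient (fun z => θ (L⁻¹ • z)) x⟫) +
            (-c) * ∫ x, ‖V x‖ ^ 2 * ⟪x, gradient (fun z => θ (L⁻¹ • z)) x⟫ :=
    fun θ hθ hθ0 L hL => profile_energy_le hsw hbr hp hVm hQm hV2 hV3 hQV hθ hθ0 hL
  exact WeakProfile.ae_eq_zero_of_locData_of_scaleIneq hρ hρ1 hVm hQm hGm hVG (β := -c) (κ := -5)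
    (by linarith) (by linarith) hA hE hD hPoisson hLE

end BreatherWeak

end Summit.NavierStokesRegularity.NavierStokesRegularity.Theorems.PowerGaugeEulerLiouville

end
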